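import Mathlib
import Literature.Analysis.FluidPDE.SelfSimilarEulerConeEnergy
import Literature.Analysis.FluidPDE.EulerReynoldsLadderGluingLimit
import Summits.AnomalousDissipation.AnomalousDissipation.Theorems.ConeDesingularisation.Negative.FluxPairing

/-!
# Flux transfer II: shells, local integrability off the origin, blow-down bookkeeping

Part of the flux-transfer package for the crux `ConeDesingularisation ↔ CascadeSoliton`
(stmt-AnomalousDissipation-19034/19036, route `PointSink`); headline and overview in
`…/ConeDesingularisation/Negative/FedConeFlux.lean`.

Geometry of the shells `{a < ‖x‖ < b}`, integrability of `L¹_loc(ℝ³∖0)` densities on them,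
iterated discrete self-similarity, the change of variables carrying the cubic / pressure defects
`‖c^{2/3}Q(c·) − V‖³`, `|c^{4/3}P(c·) − Π|^{3/2}` across a dilation, the double-shell squeeze, and
integrability of the defects and of `‖V‖²` on balls. [folklore]
-/

-- `Summit.<Summit>.<Problem>` is the tree's mandated summit-side namespace (CONVENTIONS §2).
set_option linter.dupNamespace false

noncomputable section

namespace Summit.AnomalousDissipation.AnomalousDissipation.Theorems.ConeDesingularisation.Negative

open MeasureTheory Filter Topology Set Metric
open scoped InnerProductSpace ContDiff
open Literature.Analysis.FluidPDE.EulerReynoldsLadder (isCompact_shell shell_subset_ne_zero)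
open Literature.Analysis.FluidPDE.Torus (add_pow_three_le)
open Literature.Analysis.FluidPDE

/-! ### §3 Geometry of shells, local integrability off the origin, blow-down bookkeeping -/

/-- The open shell `{a < ‖x‖ < b}` is measurable. [folklore] -/
theorem measurableSet_shell (a b : ℝ) : MeasurableSet {x : EuclideanSpace ℝ (Fin 3) | a < ‖x‖ ∧ ‖x‖ < b} :=
  ((isOpen_lt continuous_const continuous_norm).inter
    (isOpen_lt continuous_norm continuous_const)).measurableSet

/-- The open shell `{a < ‖x‖ < b}` is bounded. [folklore] -/
theorem isBounded_shell (a b : ℝ) : Bornology.IsBounded {x : EuclideanSpace ℝ (Fin 3) | a < ‖x‖ ∧ ‖x‖ < b} :=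
  (Metric.isBounded_ball (x := (0 : EuclideanSpace ℝ (Fin 3))) (r := b)).subset fun _ hx => mem_ball_zero_iff.2 hx.2

/-- A density locally integrable off the origin is integrable on every open shell `{a < ‖x‖ < b}`,
`a > 0`. [folklore] -/
theorem integrableOn_shell_of_locallyIntegrableOn {g : EuclideanSpace ℝ (Fin 3) → ℝ}
    (hg : LocallyIntegrableOn g {x : EuclideanSpace ℝ (Fin 3) | x ≠ 0} volume) {a : ℝ} (ha : 0 < a) (b : ℝ) :
    IntegrableOn g {x : EuclideanSpace ℝ (Fin 3) | a < ‖x‖ ∧ ‖x‖ < b} volume :=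
  (hg.integrableOn_compact_subset (shell_subset_ne_zero ha b) (isCompact_shell a b)).mono_set
    fun _ hx => ⟨hx.1.le, hx.2.le⟩

open scoped Pointwise in
/-- A dilation by `c > 0` maps the shell `{r < ‖x‖ < R}` onto `{c r < ‖y‖ < c R}`. [folklore] -/
theorem smul_shell {c : ℝ} (hc : 0 < c) (r R : ℝ) :
    c • {x : EuclideanSpace ℝ (Fin 3) | r < ‖x‖ ∧ ‖x‖ < R} = {y : EuclideanSpace ℝ (Fin 3) | c * r < ‖y‖ ∧ ‖y‖ < c * R} := by
  ext y
  rw [Set.mem_smul_set_iff_inv_smul_mem₀ hc.ne', Set.mem_setOf_eq, Set.mem_setOf_eq, norm_smul,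
    norm_inv, Real.norm_eq_abs, abs_of_pos hc, lt_inv_mul_iff₀ hc, inv_mul_lt_iff₀ hc]

/-- Iterated discrete self-similarity of the velocity cone: `V (λ^k x) = (λ^k)^{-2/3} V x` off the
origin. [folklore] -/
theorem dss_iterate_vel {V : EuclideanSpace ℝ (Fin 3) → EuclideanSpace ℝ (Fin 3)} {lam : ℝ} (hlam : 0 < lam)
    (hDSS : ∀ x : EuclideanSpace ℝ (Fin 3), x ≠ 0 → V (lam • x) = lam ^ (-(2 / 3 : ℝ)) • V x) (k : ℕ) (x : EuclideanSpace ℝ (Fin 3))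
    (hx : x ≠ 0) : V (lam ^ k • x) = (lam ^ k) ^ (-(2 / 3 : ℝ)) • V x := by
  induction k with
  | zero => simp
  | succ k ih =>
    have hkx : lam ^ k • x ≠ 0 := smul_ne_zero (pow_ne_zero k hlam.ne') hx
    rw [pow_succ', mul_smul, hDSS _ hkx, ih, smul_smul,
      Real.mul_rpow hlam.le (pow_nonneg hlam.le k)]

/-- Iterated discrete self-similarity of the pressure cone: `Π (λ^k x) = (λ^k)^{-4/3} Π x` off the
origin. [folklore] -/
theorem dss_iterate_pres {Pc : EuclideanSpace ℝ (Fin 3) → ℝ} {lam : ℝ} (hlam : 0 < lam)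
    (hDSS : ∀ x : EuclideanSpace ℝ (Fin 3), x ≠ 0 → Pc (lam • x) = lam ^ (-(4 / 3 : ℝ)) * Pc x) (k : ℕ) (x : EuclideanSpace ℝ (Fin 3))
    (hx : x ≠ 0) : Pc (lam ^ k • x) = (lam ^ k) ^ (-(4 / 3 : ℝ)) * Pc x := by
  induction k with
  | zero => simp
  | succ k ih =>
    have hkx : lam ^ k • x ≠ 0 := smul_ne_zero (pow_ne_zero k hlam.ne') hx
    rw [pow_succ', mul_smul, hDSS _ hkx, ih, ← mul_assoc,
      Real.mul_rpow hlam.le (pow_nonneg hlam.le k)]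

open scoped Pointwise in
/-- **Cubic defect across a dilation.** For `c > 0`, `0 ≤ r` and `V (c x) = c^{-2/3} V x` off the
origin: `∫_{r<‖x‖<R} ‖c^{2/3} Q(c x) − V x‖³ = c⁻¹ ∫_{c r<‖y‖<c R} ‖Q − V‖³`. [folklore] -/
theorem cubicDefect_dilate (Q V : EuclideanSpace ℝ (Fin 3) → EuclideanSpace ℝ (Fin 3)) {c : ℝ} (hc : 0 < c)
    (hV : ∀ x : EuclideanSpace ℝ (Fin 3), x ≠ 0 → V (c • x) = c ^ (-(2 / 3 : ℝ)) • V x) {r : ℝ} (hr : 0 ≤ r) (R : ℝ) :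
    ∫ x in {x : EuclideanSpace ℝ (Fin 3) | r < ‖x‖ ∧ ‖x‖ < R}, ‖c ^ (2 / 3 : ℝ) • Q (c • x) - V x‖ ^ 3 =
      c⁻¹ * ∫ y in {y : EuclideanSpace ℝ (Fin 3) | c * r < ‖y‖ ∧ ‖y‖ < c * R}, ‖Q y - V y‖ ^ 3 := by
  have hcr : 0 < c ^ (2 / 3 : ℝ) := Real.rpow_pos_of_pos hc _
  have hc2 : (c ^ (2 / 3 : ℝ)) ^ 3 = c ^ 2 := by
    rw [← Real.rpow_natCast, ← Real.rpow_mul hc.le]; norm_num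
  have hpt : EqOn (fun x : EuclideanSpace ℝ (Fin 3) => ‖c ^ (2 / 3 : ℝ) • Q (c • x) - V x‖ ^ 3)
      (fun x : EuclideanSpace ℝ (Fin 3) => c ^ 2 * ‖Q (c • x) - V (c • x)‖ ^ 3) {x : EuclideanSpace ℝ (Fin 3) | r < ‖x‖ ∧ ‖x‖ < R} := by
    intro x hx
    have hx0 : x ≠ 0 := by
      rintro rfl
      exact (hr.trans_lt hx.1).ne' norm_zero
    have hVx : V x = c ^ (2 / 3 : ℝ) • V (c • x) := by
      rw [hV x hx0, smul_smul, Real.rpow_neg hc.le, mul_inv_cancel₀ hcr.ne', one_smul]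
    simp only
    rw [hVx, ← smul_sub, norm_smul, Real.norm_eq_abs, abs_of_pos hcr, mul_pow, hc2]
  rw [setIntegral_congr_fun (measurableSet_shell r R) hpt, integral_const_mul,
    Measure.setIntegral_comp_smul_of_pos volume (fun y : EuclideanSpace ℝ (Fin 3) => ‖Q y - V y‖ ^ 3) _ hc,
    smul_shell hc, smul_eq_mul, finrank_euclideanSpace_fin, ← mul_assoc]
  congr 1
  field_simp

open scoped Pointwise in
/-- **Pressure defect across a dilation.** For `c > 0`, `0 ≤ r` and `Π (c x) = c^{-4/3} Π x` off
the origin: `∫_{r<‖x‖<R} |c^{4/3} P(c x) − Π x|^{3/2} = c⁻¹ ∫_{c r<‖y‖<c R} |P − Π|^{3/2}`. [folklore] -/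
theorem presDefect_dilate (P Pc : EuclideanSpace ℝ (Fin 3) → ℝ) {c : ℝ} (hc : 0 < c)
    (hPc : ∀ x : EuclideanSpace ℝ (Fin 3), x ≠ 0 → Pc (c • x) = c ^ (-(4 / 3 : ℝ)) * Pc x) {r : ℝ} (hr : 0 ≤ r) (R : ℝ) :
    ∫ x in {x : EuclideanSpace ℝ (Fin 3) | r < ‖x‖ ∧ ‖x‖ < R}, |c ^ (4 / 3 : ℝ) * P (c • x) - Pc x| ^ (3 / 2 : ℝ) =
      c⁻¹ * ∫ y in {y : EuclideanSpace ℝ (Fin 3) | c * r < ‖y‖ ∧ ‖y‖ < c * R}, |P y - Pc y| ^ (3 / 2 : ℝ) := by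
  have hcr : 0 < c ^ (4 / 3 : ℝ) := Real.rpow_pos_of_pos hc _
  have hc2 : (c ^ (4 / 3 : ℝ)) ^ (3 / 2 : ℝ) = c ^ 2 := by
    rw [← Real.rpow_mul hc.le]; norm_num
  have hpt : EqOn (fun x : EuclideanSpace ℝ (Fin 3) => |c ^ (4 / 3 : ℝ) * P (c • x) - Pc x| ^ (3 / 2 : ℝ))
      (fun x : EuclideanSpace ℝ (Fin 3) => c ^ 2 * |P (c • x) - Pc (c • x)| ^ (3 / 2 : ℝ)) {x : EuclideanSpace ℝ (Fin 3) | r < ‖x‖ ∧ ‖x‖ < R} := by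
    intro x hx
    have hx0 : x ≠ 0 := by
      rintro rfl
      exact (hr.trans_lt hx.1).ne' norm_zero
    have hPx : Pc x = c ^ (4 / 3 : ℝ) * Pc (c • x) := by
      rw [hPc x hx0, ← mul_assoc, Real.rpow_neg hc.le, mul_inv_cancel₀ hcr.ne', one_mul]
    simp only
    rw [hPx, ← mul_sub, abs_mul, abs_of_pos hcr, Real.mul_rpow hcr.le (abs_nonneg _), hc2]
  rw [setIntegral_congr_fun (measurableSet_shell r R) hpt, integral_const_mul,
    Measure.setIntegral_comp_smul_of_pos volume (fun y : EuclideanSpace ℝ (Fin 3) => |P y - Pc y| ^ (3 / 2 : ℝ)) _ hc,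
    smul_shell hc, smul_eq_mul, finrank_euclideanSpace_fin, ← mul_assoc]
  congr 1
  field_simp

/-- Squeeze over the double shell: a nonnegative density integrable on the two shells
`{1 < ‖y‖ < λ}`, `{λ < ‖y‖ < λ²}` whose integrals there tend to zero has integral over
`{1 < ‖y‖ < λ²}` tending to zero (the sphere `‖y‖ = λ` is Lebesgue-null). [folklore] -/
theorem tendsto_setIntegral_doubleShell {lam : ℝ} (hlam : 1 < lam) {F : ℕ → EuclideanSpace ℝ (Fin 3) → ℝ}
    (hF0 : ∀ k x, 0 ≤ F k x)
    (hF1 : ∀ k, IntegrableOn (F k) {y : EuclideanSpace ℝ (Fin 3) | 1 < ‖y‖ ∧ ‖y‖ < lam} volume)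
    (hF2 : ∀ k, IntegrableOn (F k) {y : EuclideanSpace ℝ (Fin 3) | lam < ‖y‖ ∧ ‖y‖ < lam ^ 2} volume)
    (h1 : Tendsto (fun k => ∫ y in {y : EuclideanSpace ℝ (Fin 3) | 1 < ‖y‖ ∧ ‖y‖ < lam}, F k y) atTop (𝓝 0))
    (h2 : Tendsto (fun k => ∫ y in {y : EuclideanSpace ℝ (Fin 3) | lam < ‖y‖ ∧ ‖y‖ < lam ^ 2}, F k y) atTop (𝓝 0)) :
    Tendsto (fun k => ∫ y in {y : EuclideanSpace ℝ (Fin 3) | 1 < ‖y‖ ∧ ‖y‖ < lam ^ 2}, F k y) atTop (𝓝 0) := by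
  have hlam0 : 0 < lam := one_pos.trans hlam
  set S₀ := {y : EuclideanSpace ℝ (Fin 3) | 1 < ‖y‖ ∧ ‖y‖ < lam}
  set S₁ := {y : EuclideanSpace ℝ (Fin 3) | lam < ‖y‖ ∧ ‖y‖ < lam ^ 2}
  set A := {y : EuclideanSpace ℝ (Fin 3) | 1 < ‖y‖ ∧ ‖y‖ < lam ^ 2}
  have hdisj : Disjoint S₀ S₁ := Set.disjoint_left.2 fun y hy hy' => lt_asymm hy.2 hy'.1
  have hnull : volume (A \ (S₀ ∪ S₁)) = 0 := by
    refine measure_mono_null (fun y hy => ?_) (Measure.addHaar_sphere_of_ne_zero volume (0 : EuclideanSpace ℝ (Fin 3)) hlam0.ne')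
    obtain ⟨⟨h1y, h2y⟩, hy⟩ := hy
    simp only [Set.mem_union, Set.mem_setOf_eq, not_or, not_and, not_lt, S₀, S₁] at hy
    have hle : lam ≤ ‖y‖ := hy.1 h1y
    have hge : ‖y‖ ≤ lam := by
      by_contra h
      exact absurd (hy.2 (not_le.1 h)) (not_le.2 h2y)
    exact mem_sphere_zero_iff_norm.2 (le_antisymm hge hle)
  have hAle : A ≤ᵐ[volume] (S₀ ∪ S₁ : Set (EuclideanSpace ℝ (Fin 3))) := ae_le_set.2 hnull
  have hub : ∀ k, ∫ y in A, F k y ≤ (∫ y in S₀, F k y) + ∫ y in S₁, F k y := fun k => by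
    rw [← setIntegral_union hdisj (measurableSet_shell _ _) (hF1 k) (hF2 k)]
    exact setIntegral_mono_set ((hF1 k).union (hF2 k)) (Eventually.of_forall fun y => hF0 k y) hAle
  refine squeeze_zero (fun k => integral_nonneg fun y => hF0 k y) hub ?_
  simpa using h1.add h2

/-- The cubic defect `‖u − V‖³` (`u` continuous, `‖V‖³ ∈ L¹_loc(ℝ³∖0)`) is integrable on every
open shell `{a < ‖x‖ < b}`, `a > 0`. [folklore] -/
theorem integrableOn_cubicDefect_shell {u V : EuclideanSpace ℝ (Fin 3) → EuclideanSpace ℝ (Fin 3)} (hu : Continuous u)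
    (hVm : AEStronglyMeasurable V volume)
    (hV3 : LocallyIntegrableOn (fun x => ‖V x‖ ^ 3) {x : EuclideanSpace ℝ (Fin 3) | x ≠ 0} volume) {a : ℝ} (ha : 0 < a)
    (b : ℝ) : IntegrableOn (fun x => ‖u x - V x‖ ^ 3) {x : EuclideanSpace ℝ (Fin 3) | a < ‖x‖ ∧ ‖x‖ < b} volume := by
  set K := {x : EuclideanSpace ℝ (Fin 3) | a ≤ ‖x‖ ∧ ‖x‖ ≤ b}
  have hK : IsCompact K := isCompact_shell a b
  obtain ⟨M, hM⟩ := hK.exists_bound_of_continuousOn hu.continuousOn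
  have hM0 : 0 ≤ max M 0 := le_max_right _ _
  have hVK : IntegrableOn (fun x => ‖V x‖ ^ 3) K volume :=
    hV3.integrableOn_compact_subset (shell_subset_ne_zero ha b) hK
  have hKm : MeasurableSet K := hK.measurableSet
  haveI : IsFiniteMeasure (volume.restrict K) :=
    ⟨by rw [Measure.restrict_apply_univ]; exact hK.measure_lt_top⟩
  have hint : IntegrableOn (fun x => ‖u x - V x‖ ^ 3) K volume := by
    refine Integrable.mono' ((integrable_const (4 * max M 0 ^ 3)).add (hVK.const_mul 4))
      ((hu.aestronglyMeasurable.sub hVm).norm.pow 3).restrict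
      ((ae_restrict_mem hKm).mono fun x hx => ?_)
    rw [Real.norm_of_nonneg (pow_nonneg (norm_nonneg _) 3)]
    have h1 : ‖u x - V x‖ ≤ max M 0 + ‖V x‖ :=
      (norm_sub_le _ _).trans (add_le_add ((hM x hx).trans (le_max_left _ _)) le_rfl)
    calc ‖u x - V x‖ ^ 3 ≤ (max M 0 + ‖V x‖) ^ 3 := pow_le_pow_left₀ (norm_nonneg _) h1 3
      _ ≤ 4 * (max M 0 ^ 3 + ‖V x‖ ^ 3) := add_pow_three_le hM0 (norm_nonneg _)
      _ = 4 * max M 0 ^ 3 + 4 * ‖V x‖ ^ 3 := by ring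
  exact hint.mono_set fun x hx => ⟨hx.1.le, hx.2.le⟩

/-- The pressure defect `|p − Π|^{3/2}` (`p` continuous, `|Π|^{3/2} ∈ L¹_loc(ℝ³∖0)`) is integrable on
every open shell `{a < ‖x‖ < b}`, `a > 0`. [folklore] -/
theorem integrableOn_presDefect_shell {p Pc : EuclideanSpace ℝ (Fin 3) → ℝ} (hp : Continuous p)
    (hPcm : AEStronglyMeasurable Pc volume)
    (hPc : LocallyIntegrableOn (fun x => |Pc x| ^ (3 / 2 : ℝ)) {x : EuclideanSpace ℝ (Fin 3) | x ≠ 0} volume) {a : ℝ}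
    (ha : 0 < a) (b : ℝ) :
    IntegrableOn (fun x => |p x - Pc x| ^ (3 / 2 : ℝ)) {x : EuclideanSpace ℝ (Fin 3) | a < ‖x‖ ∧ ‖x‖ < b} volume := by
  set K := {x : EuclideanSpace ℝ (Fin 3) | a ≤ ‖x‖ ∧ ‖x‖ ≤ b}
  have hK : IsCompact K := isCompact_shell a b
  obtain ⟨M, hM⟩ := hK.exists_bound_of_continuousOn hp.continuousOn
  have hM0 : 0 ≤ max M 0 := le_max_right _ _
  have hPK : IntegrableOn (fun x => |Pc x| ^ (3 / 2 : ℝ)) K volume :=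
    hPc.integrableOn_compact_subset (shell_subset_ne_zero ha b) hK
  have hKm : MeasurableSet K := hK.measurableSet
  haveI : IsFiniteMeasure (volume.restrict K) :=
    ⟨by rw [Measure.restrict_apply_univ]; exact hK.measure_lt_top⟩
  have hint : IntegrableOn (fun x => |p x - Pc x| ^ (3 / 2 : ℝ)) K volume := by
    refine Integrable.mono' ((integrable_const (3 * max M 0 ^ (3 / 2 : ℝ))).add (hPK.const_mul 3))
      ((continuous_id.rpow_const fun _ => Or.inr (by norm_num)).comp_aestronglyMeasurable
        (continuous_abs.comp_aestronglyMeasurable (hp.aestronglyMeasurable.sub hPcm))).restrict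
      ((ae_restrict_mem hKm).mono fun x hx => ?_)
    rw [Real.norm_of_nonneg (Real.rpow_nonneg (abs_nonneg _) _)]
    have h1 : |p x - Pc x| ≤ max M 0 + |Pc x| :=
      (abs_sub _ _).trans (add_le_add (((Real.norm_eq_abs _).symm.le.trans (hM x hx)).trans
        (le_max_left _ _)) le_rfl)
    calc |p x - Pc x| ^ (3 / 2 : ℝ) ≤ (max M 0 + |Pc x|) ^ (3 / 2 : ℝ) :=
          Real.rpow_le_rpow (abs_nonneg _) h1 (by norm_num)
      _ ≤ 3 * (max M 0 ^ (3 / 2 : ℝ) + |Pc x| ^ (3 / 2 : ℝ)) :=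
          add_rpow_threeHalves_le hM0 (abs_nonneg _)
      _ = 3 * max M 0 ^ (3 / 2 : ℝ) + 3 * |Pc x| ^ (3 / 2 : ℝ) := by ring
  exact hint.mono_set fun x hx => ⟨hx.1.le, hx.2.le⟩

/-- `‖V‖²` of a discretely self-similar cone with `‖V‖² ∈ L¹_loc(ℝ³∖0)` is integrable on every
ball (`DSSCone.normSq_integrableOn_ball` for the unit ball, local integrability outside).
[folklore] -/
theorem dssCone_normSq_integrableOn_ball {lam : ℝ} {V : EuclideanSpace ℝ (Fin 3) → EuclideanSpace ℝ (Fin 3)} (hlam : 1 < lam)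
    (hV : ∀ x : EuclideanSpace ℝ (Fin 3), x ≠ 0 → V (lam • x) = lam ^ (-(2 / 3 : ℝ)) • V x)
    (hV2 : LocallyIntegrableOn (fun x => ‖V x‖ ^ 2) {x : EuclideanSpace ℝ (Fin 3) | x ≠ 0} volume) {R : ℝ}
    (_hR : 0 < R) : IntegrableOn (fun x => ‖V x‖ ^ 2) (ball (0 : EuclideanSpace ℝ (Fin 3)) R) volume := by
  have h1 := DSSCone.normSq_integrableOn_ball hlam hV hV2
  have h2 : IntegrableOn (fun x => ‖V x‖ ^ 2) {x : EuclideanSpace ℝ (Fin 3) | 2⁻¹ ≤ ‖x‖ ∧ ‖x‖ ≤ R} volume :=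
    hV2.integrableOn_compact_subset (shell_subset_ne_zero (by norm_num) R)
      (isCompact_shell _ R)
  exact (h1.union h2).mono_set fun x hx => by
    by_cases h : ‖x‖ < 1
    · exact Or.inl (mem_ball_zero_iff.2 h)
    · exact Or.inr ⟨by linarith [not_lt.1 h], (mem_ball_zero_iff.1 hx).le⟩

end Summit.AnomalousDissipation.AnomalousDissipation.Theorems.ConeDesingularisation.Negative
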